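/-
Copyright (c) 2026. All rights reserved.
Released under Apache 2.0 license as described in the file LICENSE.
Authors: abc-iut cell, seat abc-iut-w5-d006 (gen 4).
-/
import Literature.GroupTheory.StronglyCompleteWildReduction

/-!
# The abelian layer for a finitely normally generated subgroup: hypothesis (c) discharged

Sequel of `Literature/GroupTheory/StronglyCompleteWildReduction.lean` (same seat).  There, the ABELIAN
LAYER `exists_isOpen_inf_le_of_commutatorClosure_le` shows that a `G`-normal finite-index subgroup `N` of a
closed normal subgroup `P ⊴ G` with `cl⁅P,P⁆ ≤ N` is open in `P`, PROVIDED (c): the closed subgroup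
topologically generated by `⁅P, U⁆` and the `n`-th powers of `P` is open in `P` (for the relevant open normal
`U ⊇ P` and `n = [P : N]`) — a "finiteness of coinvariants".  Here (c) is DISCHARGED from a purely
group-theoretic hypothesis: `P` is topologically generated by the `G`-conjugates of a FINITE set `E`
("`P` is topologically finitely normally generated in `G`" — e.g. the kernel of a continuous surjection from a
topologically finitely generated profinite group onto a finitely presented one; for `G = G_k` the absolute
Galois group of a `p`-adic field and `P` its wild inertia this is the finite normal generation of `P` over
the tame quotient):

* `exists_isOpen_inf_le_commutator_pow_closure_of_normalGenerators` — for `U ⊇ P` open normal and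
  `n ≥ 1`, the closed subgroup `T = cl(⁅P,U⁆ · Pⁿ)` is open in `P`.  Proof: modulo the normal subgroup
  `⁅P,U⁆`, a conjugate `g e g⁻¹` (`e ∈ E`) depends only on the coset `gU`, so `P / T` — a compact Hausdorff
  ABELIAN group of exponent dividing `n` — is topologically generated by at most `[G:U]·|E|` elements of
  finite order; the abstract subgroup they generate is finite (commutative: `⟨a⟩ ⊔ K = ⟨a⟩·K`), hence
  closed, hence everything: `P/T` is finite and `T` is open in `P`.
* `exists_isOpen_inf_le_of_commutatorClosure_le_of_normalGenerators` — consequently, for `G` profinite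
  and topologically finitely generated, `P ⊴ G` closed and topologically finitely normally generated with
  (a) every finite-index subgroup of `G` containing `P` open: EVERY `G`-normal finite-index `N` with
  `cl⁅P,P⁆ ≤ N ≤ P` is open in `P` — i.e. the finite `G`-equivariant quotients of `P / cl⁅P,P⁆` are all
  continuous, with NO further hypothesis.

HONEST FRAMING: elementary profinite group theory; the Nikolov–Segal-type residual (d′) of the parent file
(closedness of the ABSTRACT subgroups `⟨⁅P′,U⁆ ∪ P′ⁿ⟩` for the non-abelian layers) is untouched.  Nothing
here bears on [IUTchIII] Cor. 3.12 or asserts anything about abc.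
-/

namespace Literature.GroupTheory

open scoped Pointwise commutatorElement

variable {G : Type*} [Group G] [TopologicalSpace G] [IsTopologicalGroup G]
  [CompactSpace G] [TotallyDisconnectedSpace G]

/-- **Finiteness of coinvariants from finite normal generation.** Let `P ⊴ G` be a closed normal
subgroup of the profinite group `G`, topologically generated by the `G`-conjugates of a finite set `E ⊆ P`,
let `U ⊇ P` be an open normal subgroup and `n ≥ 1`. Then the closed subgroup topologically generated by
`⁅P, U⁆` and `{yⁿ : y ∈ P}` is open in `P`: `V ∩ P ⊆ cl(⁅P,U⁆ ⊔ ⟨Pⁿ⟩)` for some open subgroup `V`.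
(Modulo `⁅P, U⁆` the conjugate `g e g⁻¹` only depends on `gU`; the quotient of `P` by that closed subgroup
is a compact Hausdorff abelian group of exponent dividing `n` topologically generated by finitely many
elements, hence finite.) This is hypothesis (c) of `exists_isOpen_inf_le_of_commutatorClosure_le`; an
elementary step in the strong-completeness toolkit of the cited section. [cite: RibesZalesskii2010, §4.2] -/
theorem exists_isOpen_inf_le_commutator_pow_closure_of_normalGenerators (P : Subgroup G) [hPn : P.Normal]
    (hPc : IsClosed (P : Set G)) (E : Finset G) (hEP : (E : Set G) ⊆ P)
    (hgen : P ≤ (Subgroup.closure {x : G | ∃ g : G, ∃ e ∈ E, x = g * e * g⁻¹}).topologicalClosure)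
    (U : Subgroup G) [hUn : U.Normal] (hUo : IsOpen (U : Set G)) (hPU : P ≤ U) (n : ℕ) (hn : n ≠ 0) :
    ∃ V : Subgroup G, IsOpen (V : Set G) ∧
      V ⊓ P ≤ (⁅P, U⁆ ⊔ Subgroup.closure {y | ∃ x ∈ P, x ^ n = y}).topologicalClosure := by
  classical
  haveI : CompactSpace P := isCompact_iff_compactSpace.mp hPc.isCompact
  set T : Subgroup G := (⁅P, U⁆ ⊔ Subgroup.closure {y | ∃ x ∈ P, x ^ n = y}).topologicalClosure with hT
  have hTP : T ≤ P := by
    refine Subgroup.topologicalClosure_minimal _ (sup_le (Subgroup.commutator_le_left P U) ?_) hPc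
    rw [Subgroup.closure_le]
    rintro _ ⟨x, hx, rfl⟩
    exact P.pow_mem hx n
  have hPUT : ⁅P, U⁆ ≤ T := le_sup_left.trans (Subgroup.le_topologicalClosure _)
  have hpowT : ∀ y ∈ P, y ^ n ∈ T := fun y hy =>
    Subgroup.le_topologicalClosure _ (Subgroup.mem_sup_right (Subgroup.subset_closure ⟨y, hy, rfl⟩))
  have hcommT : ∀ x ∈ P, ∀ y ∈ P, ⁅x, y⁆ ∈ T := fun x hx y hy =>
    hPUT (Subgroup.commutator_mem_commutator hx (hPU hy))
  -- the quotient `Q = P / T`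
  set T' : Subgroup P := T.subgroupOf P with hT'
  haveI : T'.Normal := by
    refine ⟨fun t ht x => ?_⟩
    rw [hT', Subgroup.mem_subgroupOf] at ht ⊢
    have : ((x * t * x⁻¹ : P) : G) = ⁅((x : P) : G), ((t : P) : G)⁆ * (t : G) := by
      simp only [commutatorElement_def, Subgroup.coe_mul, Subgroup.coe_inv]; group
    rw [this]
    exact T.mul_mem (hcommT _ x.2 _ t.2) ht
  have hT'c : IsClosed ((T' : Subgroup P) : Set P) := by
    rw [hT', Subgroup.coe_subgroupOf]
    exact (Subgroup.isClosed_topologicalClosure _).preimage continuous_subtype_val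
  haveI : IsClosed ((T' : Subgroup P) : Set P) := hT'c
  let π : P →* P ⧸ T' := QuotientGroup.mk' T'
  have hπc : Continuous π := QuotientGroup.continuous_mk
  have hcomm : ∀ a b : P ⧸ T', a * b = b * a := by
    intro a b
    induction a using QuotientGroup.induction_on with | H x =>
    induction b using QuotientGroup.induction_on with | H y =>
    rw [← QuotientGroup.mk_mul, ← QuotientGroup.mk_mul, QuotientGroup.eq, hT', Subgroup.mem_subgroupOf]
    have : (((x * y)⁻¹ * (y * x) : P) : G) = ⁅((y : P) : G)⁻¹, ((x : P) : G)⁻¹⁆ := by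
      simp only [commutatorElement_def, Subgroup.coe_mul, Subgroup.coe_inv, inv_inv, mul_inv_rev]
      group
    rw [this]
    exact hcommT _ (P.inv_mem y.2) _ (P.inv_mem x.2)
  have hnormal : ∀ K : Subgroup (P ⧸ T'), K.Normal := fun K =>
    ⟨fun a ha g => by rwa [hcomm g a, mul_inv_cancel_right]⟩
  have hpow : ∀ q : P ⧸ T', q ^ n = 1 := by
    intro q
    induction q using QuotientGroup.induction_on with | H y =>
    rw [← QuotientGroup.mk_pow, QuotientGroup.eq_one_iff, hT', Subgroup.mem_subgroupOf, Subgroup.coe_pow]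
    exact hpowT _ y.2
  -- finitely generated subgroups of `Q` are finite
  have hfin : ∀ S : Finset (P ⧸ T'), ((Subgroup.closure (S : Set (P ⧸ T')) : Subgroup (P ⧸ T')) :
      Set (P ⧸ T')).Finite := by
    intro S
    induction S using Finset.induction_on with
    | empty => simp
    | insert a s ha ih =>
      rw [Finset.coe_insert, Set.insert_eq, Subgroup.closure_union, ← Subgroup.zpowers_eq_closure]
      haveI := hnormal (Subgroup.closure (s : Set (P ⧸ T')))
      rw [Subgroup.mul_normal]
      refine Set.Finite.mul ?_ ih
      have hord : IsOfFinOrder a := isOfFinOrder_iff_pow_eq_one.mpr ⟨n, Nat.pos_of_ne_zero hn, hpow a⟩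
      haveI : Finite (Subgroup.zpowers a) :=
        Nat.finite_of_card_ne_zero (by rw [Nat.card_zpowers]; exact hord.orderOf_pos.ne')
      exact Set.toFinite _
  -- representatives of `G / U` and the finite set of conjugates of `E` modulo `T`
  haveI : Finite (G ⧸ U) := Subgroup.quotient_finite_of_isOpen U hUo
  letI : Fintype (G ⧸ U) := Fintype.ofFinite _
  have hconjP : ∀ (g : G), ∀ e ∈ E, g * e * g⁻¹ ∈ P := fun g e he => hPn.conj_mem _ (hEP he) g
  let S : Finset (P ⧸ T') :=
    (Finset.univ ×ˢ E.attach).image fun ce : (G ⧸ U) × {e // e ∈ E} =>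
      π ⟨ce.1.out * (ce.2 : G) * ce.1.out⁻¹, hconjP _ _ ce.2.2⟩
  set A : Subgroup (P ⧸ T') := Subgroup.closure (S : Set (P ⧸ T')) with hA
  -- every conjugate `g e g⁻¹` lies in `A` modulo `T`
  have hconjA : ∀ (g : G) (e : G) (he : e ∈ E), π ⟨g * e * g⁻¹, hconjP g e he⟩ ∈ A := by
    intro g e he
    have hru : ((QuotientGroup.mk g : G ⧸ U).out)⁻¹ * g ∈ U := by
      rw [← QuotientGroup.eq, QuotientGroup.out_eq']
    have hu' : g⁻¹ * (QuotientGroup.mk g : G ⧸ U).out ∈ U := by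
      have := U.inv_mem hru
      simpa only [mul_inv_rev, inv_inv] using this
    have heq : π ⟨g * e * g⁻¹, hconjP g e he⟩ =
        π ⟨(QuotientGroup.mk g : G ⧸ U).out * e * ((QuotientGroup.mk g : G ⧸ U).out)⁻¹,
          hconjP _ e he⟩ := by
      refine (QuotientGroup.eq).mpr ?_
      rw [hT', Subgroup.mem_subgroupOf]
      have : (((⟨g * e * g⁻¹, hconjP g e he⟩ : P)⁻¹ *
          ⟨(QuotientGroup.mk g : G ⧸ U).out * e * ((QuotientGroup.mk g : G ⧸ U).out)⁻¹,
            hconjP _ e he⟩ : P) : G) =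
          g * ⁅e⁻¹, g⁻¹ * (QuotientGroup.mk g : G ⧸ U).out⁆ * g⁻¹ := by
        simp only [commutatorElement_def, Subgroup.coe_mul, Subgroup.coe_inv, mul_inv_rev, inv_inv]
        group
      rw [this]
      exact hPUT ((inferInstance : (⁅P, U⁆).Normal).conj_mem _
        (Subgroup.commutator_mem_commutator (P.inv_mem (hEP he)) hu') g)
    rw [heq, hA]
    refine Subgroup.subset_closure (Finset.mem_coe.mpr (Finset.mem_image.mpr ?_))
    exact ⟨((QuotientGroup.mk g : G ⧸ U), ⟨e, he⟩), Finset.mem_product.mpr ⟨Finset.mem_univ _,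
      Finset.mem_attach _ _⟩, rfl⟩
  -- `A` is finite, hence closed
  have hAfin : (A : Set (P ⧸ T')).Finite := hfin S
  have hAc : IsClosed (A : Set (P ⧸ T')) := hAfin.isClosed
  -- the subgroup of `P` generated by the conjugates of `E` maps into `A`
  set Cset : Set G := {x : G | ∃ g : G, ∃ e ∈ E, x = g * e * g⁻¹} with hCset
  set C' : Subgroup P := Subgroup.closure (P.subtype ⁻¹' Cset) with hC'
  have hC'A : C'.map π ≤ A := by
    rw [hC', MonoidHom.map_closure, Subgroup.closure_le]
    rintro _ ⟨x, hx, rfl⟩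
    obtain ⟨g, e, he, hxe⟩ := hx
    have : x = ⟨g * e * g⁻¹, hconjP g e he⟩ := Subtype.ext hxe
    rw [this]
    exact hconjA g e he
  have hCC' : ((Subgroup.closure Cset : Subgroup G) : Set G) = Subtype.val '' (C' : Set P) := by
    have : (Subgroup.closure Cset : Subgroup G) = C'.map P.subtype := by
      rw [hC', MonoidHom.map_closure]
      congr 1
      ext y
      constructor
      · rintro ⟨g, e, he, rfl⟩
        exact ⟨⟨_, hconjP g e he⟩, ⟨g, e, he, rfl⟩, rfl⟩
      · rintro ⟨z, hz, rfl⟩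
        exact hz
    rw [this, Subgroup.coe_map]
    rfl
  -- density: every `x : P` lies in the closure of `C'`, so `π x ∈ closure A = A`
  have hall : ∀ x : P, π x ∈ A := by
    intro x
    have hxC : x ∈ closure (C' : Set P) := by
      rw [closure_subtype, ← hCC', ← Subgroup.topologicalClosure_coe]
      exact hgen x.2
    have h1 : π x ∈ closure (π '' (C' : Set P)) :=
      (Set.mapsTo_image π (C' : Set P)).closure hπc hxC
    have h2 : closure (π '' (C' : Set P)) ⊆ (A : Set (P ⧸ T')) := by
      rw [← hAc.closure_eq]
      refine closure_mono ?_
      rintro _ ⟨z, hz, rfl⟩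
      exact hC'A ⟨z, hz, rfl⟩
    exact h2 h1
  -- so `Q` is finite and `T'` is open in `P`
  haveI : Finite (P ⧸ T') := by
    refine Set.finite_univ_iff.mp (hAfin.subset fun q _ => ?_)
    induction q using QuotientGroup.induction_on with | H x => exact hall x
  haveI : T'.FiniteIndex := Subgroup.finiteIndex_of_finite_quotient
  have hT'o : IsOpen ((T' : Subgroup P) : Set P) := Subgroup.isOpen_of_isClosed_of_finiteIndex T' hT'c
  -- unpack: an open normal subgroup `V` of `G` with `V ∩ P ⊆ T`
  obtain ⟨O, hO, hOT⟩ := isOpen_induced_iff.mp hT'o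
  have h1O : (1 : G) ∈ O := by
    have : (1 : P) ∈ Subtype.val ⁻¹' O := by rw [hOT]; exact T'.one_mem
    exact this
  obtain ⟨V, hV⟩ := ProfiniteGrp.exist_openNormalSubgroup_sub_open_nhds_of_one hO h1O
  refine ⟨V, V.isOpen, fun x hx => ?_⟩
  obtain ⟨hxV, hxP⟩ := Subgroup.mem_inf.mp hx
  have : (⟨x, hxP⟩ : P) ∈ Subtype.val ⁻¹' O := hV hxV
  rw [hOT] at this
  exact Subgroup.mem_subgroupOf.mp this

/-- **The abelian layer, unconditionally for finitely normally generated `P`.** Let `G` be profinite and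
topologically finitely generated, `P ⊴ G` closed and topologically generated by the `G`-conjugates of a
finite set `E ⊆ P`, with (a) every finite-index subgroup of `G` containing `P` open. Then EVERY
`G`-normal subgroup `N` with `cl⁅P,P⁆ ≤ N ≤ P` and `[P : N] < ∞` is open in `P` (`V ∩ P ⊆ N` for an open
subgroup `V`): the finite `G`-equivariant quotients of `P / cl⁅P,P⁆` are continuous. (The parent file's
`exists_isOpen_inf_le_of_commutatorClosure_le` with its hypothesis (c) supplied by
`exists_isOpen_inf_le_commutator_pow_closure_of_normalGenerators`.) A PARTIAL, elementary case of the cited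
theorem, which is NOT proved here. [cite: NikolovSegal2003, Thm 1.1] -/
theorem exists_isOpen_inf_le_of_commutatorClosure_le_of_normalGenerators
    (hfg : ∃ S : Finset G, Dense ((Subgroup.closure (S : Set G) : Subgroup G) : Set G))
    (P : Subgroup G) [hPn : P.Normal] (hPc : IsClosed (P : Set G))
    (E : Finset G) (hEP : (E : Set G) ⊆ P)
    (hgen : P ≤ (Subgroup.closure {x : G | ∃ g : G, ∃ e ∈ E, x = g * e * g⁻¹}).topologicalClosure)
    (ha : ∀ K : Subgroup G, P ≤ K → K.FiniteIndex → IsOpen (K : Set G))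
    (N : Subgroup G) [hNn : N.Normal] (hNP : N ≤ P) (hDN : (⁅P, P⁆).topologicalClosure ≤ N)
    (hidx : N.relIndex P ≠ 0) :
    ∃ V : Subgroup G, IsOpen (V : Set G) ∧ V ⊓ P ≤ N :=
  exists_isOpen_inf_le_of_commutatorClosure_le hfg P hPc ha N hNP hDN hidx
    (fun U hUn hUo hPU _ => by
      haveI := hUn
      exact exists_isOpen_inf_le_commutator_pow_closure_of_normalGenerators P hPc E hEP hgen U hUo hPU
        (N.relIndex P) hidx)

end Literature.GroupTheory
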